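import Mathlib

/-!
# p1 — rank-one degeneracy: the combinatorial core of (X11)(a) (proofs/p1-lattice-calculus.md)

Abstract setting: a finite set `X` of "embeddings" with an involution `ι` (complex conjugation), a group `G` acting
transitively on `X` and commuting with `ι` (the Galois group, for `E` a field), and a CM type `Φ ⊂ X`. The exceptional
lattice is `L := {y : X → ℤ | y ∘ ι = -y ∧ ∀ g, ∑ x ∈ Φ, y (g • x) = 0}` (anti-invariant integer vectors orthogonal to every
translate `gΦ`, written as `∑_{x ∈ gΦ} y x = ∑_{x ∈ Φ} y (g • x)`). THEOREM (`rank_one`): if `L` is generated by one nonzero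
vector `w`, then `w = 1_Q − 1_{X∖Q}` for the set `Q = {w > 0}`, `Q` is an `ι`-transversal, `Q` is balanced (`2·|Φ ∩ g⁻¹Q| = |Φ|`
for every `g`, i.e. a Hodge set), and every `g` maps `Q` onto `Q` or onto its complement (orbit of size ≤ 2).
-/

namespace HodgeRepro0.P1.RankOne

variable {X : Type*} {G : Type*} [Group G] [MulAction G X]

/-- the exceptional lattice as a predicate -/
def InL (ι : X → X) (Φ : Finset X) (y : X → ℤ) : Prop :=
  (∀ x, y (ι x) = - y x) ∧ ∀ g : G, ∑ x ∈ Φ, y (g • x) = 0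

/-- translating a vector by a group element: `(act g y) x = y (g⁻¹ • x)` -/
def act (g : G) (y : X → ℤ) : X → ℤ := fun x => y (g⁻¹ • x)

/-- `L` is stable under the action when the action commutes with `ι` -/
theorem InL_act (ι : X → X) (Φ : Finset X) (hcomm : ∀ (g : G) x, g • ι x = ι (g • x))
    (y : X → ℤ) (hy : InL (G := G) ι Φ y) (g : G) : InL (G := G) ι Φ (act g y) := by
  refine ⟨fun x => ?_, fun h => ?_⟩
  · simp only [act]
    rw [hcomm g⁻¹ x]
    exact hy.1 _
  · simp only [act]
    have := hy.2 (g⁻¹ * h)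
    simpa [mul_smul] using this

/-- `act g⁻¹ ∘ act g = id` -/
theorem act_inv_act (g : G) (y : X → ℤ) : act g⁻¹ (act g y) = y := by
  funext x; simp [act, smul_smul]

/-- `act` is ℤ-linear in the vector -/
theorem act_smul (g : G) (c : ℤ) (y : X → ℤ) : act g (c • y) = c • act g y := by
  funext x; simp [act]

/-- if `L = ℤ·w` with `w ≠ 0`, every `g` maps `w` to `w` or `−w` -/
theorem act_gen_eq (ι : X → X) (Φ : Finset X) (hcomm : ∀ (g : G) x, g • ι x = ι (g • x))
    (w : X → ℤ) (hw0 : w ≠ 0) (hw : InL (G := G) ι Φ w)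
    (hgen : ∀ y, InL (G := G) ι Φ y → ∃ c : ℤ, y = c • w) (g : G) :
    act g w = w ∨ act g w = -w := by
  obtain ⟨c, hc⟩ := hgen (act g w) (InL_act ι Φ hcomm w hw g)
  obtain ⟨c', hc'⟩ := hgen (act g⁻¹ w) (InL_act ι Φ hcomm w hw g⁻¹)
  have h1 : w = (c * c') • w := by
    calc w = act g⁻¹ (act g w) := (act_inv_act g w).symm
      _ = act g⁻¹ (c • w) := by rw [hc]
      _ = c • act g⁻¹ w := act_smul _ _ _
      _ = c • (c' • w) := by rw [hc']
      _ = (c * c') • w := by rw [smul_smul]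
  obtain ⟨x, hx⟩ : ∃ x, w x ≠ 0 := Function.ne_iff.mp hw0
  have h2 : c * c' = 1 := by
    have := congrFun h1 x
    simp only [Pi.smul_apply, smul_eq_mul] at this
    have h3 : (c * c' - 1) * w x = 0 := by linarith
    rcases mul_eq_zero.mp h3 with h | h
    · linarith
    · exact absurd h hx
  rcases Int.eq_one_or_neg_one_of_mul_eq_one h2 with h | h
  · left; rw [hc, h, one_smul]
  · right; rw [hc, h]; funext x; simp

/-- the absolute value of a generator is constant under a transitive action -/
theorem abs_const (ι : X → X) (Φ : Finset X) (hcomm : ∀ (g : G) x, g • ι x = ι (g • x))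
    (htrans : ∀ x y : X, ∃ g : G, g • x = y)
    (w : X → ℤ) (hw0 : w ≠ 0) (hw : InL (G := G) ι Φ w)
    (hgen : ∀ y, InL (G := G) ι Φ y → ∃ c : ℤ, y = c • w) (x y : X) : |w y| = |w x| := by
  obtain ⟨g, hg⟩ := htrans x y
  have hx : act g⁻¹ w x = w y := by simp [act, hg]
  rcases act_gen_eq ι Φ hcomm w hw0 hw hgen g⁻¹ with h | h
  · rw [← hx, h]
  · rw [← hx, h]; simp

/-- the nonzero values of a generator: every `w x` is `c₀` or `−c₀` with `c₀ = |w x₀| > 0` -/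
theorem values (ι : X → X) (Φ : Finset X) (hcomm : ∀ (g : G) x, g • ι x = ι (g • x))
    (htrans : ∀ x y : X, ∃ g : G, g • x = y)
    (w : X → ℤ) (hw0 : w ≠ 0) (hw : InL (G := G) ι Φ w)
    (hgen : ∀ y, InL (G := G) ι Φ y → ∃ c : ℤ, y = c • w) :
    ∃ c₀ : ℤ, 0 < c₀ ∧ ∀ x, w x = c₀ ∨ w x = -c₀ := by
  obtain ⟨x₀, hx₀⟩ : ∃ x, w x ≠ 0 := Function.ne_iff.mp hw0
  refine ⟨|w x₀|, abs_pos.mpr hx₀, fun x => ?_⟩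
  have h := abs_const ι Φ hcomm htrans w hw0 hw hgen x₀ x
  rcases abs_eq (abs_nonneg (w x₀)) |>.mp h with h1 | h1
  · left; exact h1
  · right; exact h1

/-- MAIN THEOREM (rank-one degeneracy, (X11)(a)): if the exceptional lattice is `ℤ·w`, then `w = 1_Q − 1_{X∖Q}` for
`Q = {w > 0}`, `Q` is an `ι`-transversal, `Q` is balanced (a Hodge set), and every group element maps `Q` onto `Q` or
onto its complement. -/
theorem rank_one [Fintype X] [DecidableEq X] (ι : X → X) (Φ : Finset X)
    (hcomm : ∀ (g : G) x, g • ι x = ι (g • x)) (htrans : ∀ x y : X, ∃ g : G, g • x = y)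
    (w : X → ℤ) (hw0 : w ≠ 0) (hw : InL (G := G) ι Φ w)
    (hgen : ∀ y, InL (G := G) ι Φ y → ∃ c : ℤ, y = c • w) :
    (∀ x, w x = if 0 < w x then 1 else -1) ∧
    (∀ x, (0 < w x) ↔ ¬ (0 < w (ι x))) ∧
    (∀ g : G, 2 * (Φ.filter (fun x => 0 < w (g • x))).card = Φ.card) ∧
    (∀ g : G, (∀ x, 0 < w (g • x) ↔ 0 < w x) ∨ (∀ x, 0 < w (g • x) ↔ ¬ 0 < w x)) := by
  obtain ⟨c₀, hc₀, hval⟩ := values ι Φ hcomm htrans w hw0 hw hgen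
  -- the sign vector v and w = c₀ • v
  set v : X → ℤ := fun x => if 0 < w x then 1 else -1 with hv
  have hwv : ∀ x, w x = c₀ * v x := by
    intro x
    rcases hval x with h | h
    · have : 0 < w x := h ▸ hc₀
      show w x = c₀ * (if 0 < w x then 1 else -1)
      rw [if_pos this, mul_one, h]
    · have : ¬ 0 < w x := by rw [h]; linarith
      show w x = c₀ * (if 0 < w x then 1 else -1)
      rw [if_neg this, mul_neg, mul_one, h]
  -- v is in L
  have hvL : InL (G := G) ι Φ v := by
    refine ⟨fun x => ?_, fun g => ?_⟩
    · have h1 := hw.1 x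
      rw [hwv, hwv] at h1
      have : v (ι x) = - v x := by
        have h2 : c₀ * (v (ι x) + v x) = 0 := by linarith
        rcases mul_eq_zero.mp h2 with h | h
        · linarith
        · linarith
      exact this
    · have h1 := hw.2 g
      have h2 : ∑ x ∈ Φ, w (g • x) = c₀ * ∑ x ∈ Φ, v (g • x) := by
        rw [Finset.mul_sum]; exact Finset.sum_congr rfl (fun x _ => hwv _)
      rw [h2] at h1
      rcases mul_eq_zero.mp h1 with h | h
      · linarith
      · exact h
  -- hence v = c • w = (c * c₀) • v, so c₀ = 1 and w = v
  have hc₀1 : c₀ = 1 := by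
    obtain ⟨c, hc⟩ := hgen v hvL
    obtain ⟨x₀, hx₀⟩ : ∃ x, w x ≠ 0 := Function.ne_iff.mp hw0
    have h1 := congrFun hc x₀
    simp only [Pi.smul_apply, smul_eq_mul] at h1
    rw [hwv x₀] at h1
    have hvx : v x₀ = 1 ∨ v x₀ = -1 := by
      simp only [hv]; split_ifs <;> simp
    have h2 : c * c₀ = 1 := by
      rcases hvx with h | h <;> rw [h] at h1 <;> linarith
    rcases Int.eq_one_or_neg_one_of_mul_eq_one' h2 with ⟨_, h⟩ | ⟨_, h⟩
    · exact h
    · linarith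
  have hwv1 : ∀ x, w x = v x := by intro x; rw [hwv x, hc₀1, one_mul]
  refine ⟨fun x => hwv1 x, fun x => ?_, fun g => ?_, fun g => ?_⟩
  · -- transversal
    have h1 := hw.1 x
    constructor
    · intro hx; rw [h1]; linarith
    · intro hx
      rcases hval x with h | h
      · rw [h]; exact hc₀
      · exfalso; apply hx; rw [h1, h]; linarith
  · -- balanced
    have h1 := hvL.2 g
    have h2 : ∑ x ∈ Φ, v (g • x) = ((Φ.filter (fun x => 0 < w (g • x))).card : ℤ) - ((Φ.filter (fun x => ¬ 0 < w (g • x))).card : ℤ) := by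
      simp only [hv]
      rw [Finset.sum_ite]
      simp only [Finset.sum_const, nsmul_eq_mul, mul_one, mul_neg, sub_eq_add_neg]
    have h3 := Finset.card_filter_add_card_filter_not (s := Φ) (fun x => 0 < w (g • x))
    have h4 : ((Φ.filter (fun x => 0 < w (g • x))).card : ℤ) = ((Φ.filter (fun x => ¬ 0 < w (g • x))).card : ℤ) := by linarith
    have h5 : (2 * (Φ.filter (fun x => 0 < w (g • x))).card : ℤ) = (Φ.card : ℤ) := by
      have := congrArg (fun n : ℕ => (n : ℤ)) h3
      push_cast at this
      linarith
    exact_mod_cast h5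
  · -- orbit of size ≤ 2
    rcases act_gen_eq ι Φ hcomm w hw0 hw hgen g⁻¹ with h | h
    · left; intro x
      have := congrFun h x
      simp only [act, inv_inv] at this
      rw [this]
    · right; intro x
      have := congrFun h x
      simp only [act, inv_inv, Pi.neg_apply] at this
      rw [this]
      rcases hval x with h' | h'
      · rw [h']; constructor <;> intro <;> linarith
      · rw [h']; constructor <;> intro <;> linarith

end HodgeRepro0.P1.RankOne
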